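import Literature.Analysis.PDE.WeakHarnackPointwise
import Literature.Analysis.PDE.WeakHarnackCutoff
import Literature.Analysis.PDE.WeakHarnackLogProduct
import HarnessLib

/-!
# The Krylov–Safonov barrier inequality (Gilbarg–Trudinger, proof of Thm. 9.22, p. 247)

Glue of the pointwise algebra (`WeakHarnackPointwise`) with the calculus of the cutoff
(`WeakHarnackCutoff`) and of `-log`/products (`WeakHarnackLogProduct`): for a `C²`
supersolution `a^{ij}D_{ij}u ≤ f` near a point `y` of the unit ball with `u + N > 0`, the function
`v = η w`, `η = (1-|x|²)^β`, `w = -log(u+N)`, satisfies at `y`, whenever `v(y) > 0`,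
`-a^{ij}D_{ij}v ≤ 4β²Λ + (f/(u+N))⁺ + (2βnΛ/(1-α²)) v 𝟙_{|y|<α}`
(`neg_pair_hessianMatrix_barrier_le`) — GT's inequality preceding (9.54), with `b = c = 0`.

## References

* D. Gilbarg, N. S. Trudinger, *Elliptic Partial Differential Equations of Second Order* (2001),
  proof of Theorem 9.22, p. 247. [GilbargTrudinger2001]
-/

noncomputable section

open Set InnerProductSpace RealInnerProductSpace Matrix Filter
open scoped Topology

namespace Literature.Analysis.PDE.KrylovSafonov

open Literature.Analysis.PDE.ABP

variable {E : Type*} [NormedAddCommGroup E] [InnerProductSpace ℝ E]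
  {ι : Type*} [Fintype ι] [DecidableEq ι]

/-- **The barrier function** `v = η_m · (-log(u + N))`. [cite: GilbargTrudinger2001, (9.53)] -/
def barrier (m : ℕ) (u : E → ℝ) (N : ℝ) (x : E) : ℝ := eta m x * -Real.log (u x + N)

omit [Fintype ι] [DecidableEq ι] in
/-- The Hessian of `u + N` is that of `u`. [folklore] -/
theorem fderiv_add_const_fun (u : E → ℝ) (N : ℝ) :
    fderiv ℝ (fun z ↦ u z + N) = fderiv ℝ u := by
  funext z; exact fderiv_add_const N

omit [DecidableEq ι] in
/-- The Hessian matrix of `u + N` is that of `u`. [folklore] -/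
theorem hessianMatrix_add_const (u : E → ℝ) (N : ℝ) (b : OrthonormalBasis ι ℝ E) (x : E) :
    hessianMatrix (fun z ↦ u z + N) b x = hessianMatrix u b x := by
  ext i j; simp [hessianMatrix_apply, fderiv_add_const_fun]

/-- **The barrier inequality** (GT p. 247, `b = c = 0`). At a point `y` with `‖y‖ < 1` and
`v(y) > 0`, for `u` differentiable with `u + N > 0` near `y` and twice differentiable at `y`,
`a(y)` symmetric with `λ|ξ|² ≤ a ξ·ξ ≤ Λ|ξ|²` (`λ > 0`), `a^{ij}D_{ij}u(y) ≤ f(y)`, `β = m + 2` with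
`nΛ ≤ 2(β-1)λα²`, `α² < 1`:
`-a^{ij}D_{ij}v(y) ≤ 4β²Λ + (f(y)/(u(y)+N))⁺ + (2βnΛ/(1-α²)) v(y) 𝟙_{‖y‖² < α²}`.
[cite: GilbargTrudinger2001, proof of Thm 9.22, displays 1–3 on p. 247] -/
theorem neg_pair_hessianMatrix_barrier_le (b : OrthonormalBasis ι ℝ E) {u f : E → ℝ} {N : ℝ}
    {a : E → Matrix ι ι ℝ} {m : ℕ} {lam Λ α : ℝ} {y : E} (hy : ‖y‖ < 1)
    (hu : ∀ᶠ z in 𝓝 y, DifferentiableAt ℝ u z ∧ 0 < u z + N)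
    (hu2 : DifferentiableAt ℝ (fderiv ℝ u) y)
    (ha : (a y).IsSymm) (hlam0 : 0 < lam) (hΛ0 : 0 ≤ Λ)
    (hlam : ∀ ξ : ι → ℝ, lam * (ξ ⬝ᵥ ξ) ≤ ξ ⬝ᵥ (a y *ᵥ ξ))
    (hΛ : ∀ ξ : ι → ℝ, ξ ⬝ᵥ (a y *ᵥ ξ) ≤ Λ * (ξ ⬝ᵥ ξ))
    (hsuper : pair (a y) (hessianMatrix u b y) ≤ f y) (hα1 : α ^ 2 < 1)
    (hβl : Fintype.card ι * Λ ≤ 2 * (((m + 2 : ℕ) : ℝ) - 1) * lam * α ^ 2)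
    (hv : 0 < barrier m u N y) :
    -pair (a y) (hessianMatrix (barrier m u N) b y) ≤
      4 * ((m + 2 : ℕ) : ℝ) ^ 2 * Λ + max (f y / (u y + N)) 0 +
        (if ‖y‖ ^ 2 < α ^ 2 then
          (2 * ((m + 2 : ℕ) : ℝ) * (Fintype.card ι * Λ) / (1 - α ^ 2)) * barrier m u N y
        else 0) := by
  -- data at `y`
  set φ : E → ℝ := fun z ↦ u z + N with hφ
  set w : E → ℝ := fun z ↦ -Real.log (φ z) with hw
  set xc : ι → ℝ := fun i ↦ ⟪y, b i⟫ with hxc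
  have hs : ‖y‖ ^ 2 = xc ⬝ᵥ xc := normSq_eq_dotProduct b y
  have hs1 : xc ⬝ᵥ xc < 1 := by
    rw [← hs]; nlinarith [norm_nonneg y]
  have hφev : ∀ᶠ z in 𝓝 y, DifferentiableAt ℝ φ z ∧ 0 < φ z := by
    filter_upwards [hu] with z hz
    exact ⟨hz.1.add_const N, hz.2⟩
  obtain ⟨hφy, hφpos⟩ := hφev.self_of_nhds
  have hφ2 : DifferentiableAt ℝ (fderiv ℝ φ) y := by rw [hφ, fderiv_add_const_fun]; exact hu2
  -- positivity of `η` and `w` at `y`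
  have hη : 0 < eta m y := by
    rw [eta]; exact pow_pos (by nlinarith [norm_nonneg y]) _
  have hwpos : 0 < w y := by
    have : barrier m u N y = eta m y * w y := rfl
    rw [this] at hv
    exact pos_of_mul_pos_right hv hη.le  -- hmm: pos_of_mul_pos_right : 0 < a * b → 0 ≤ a → 0 < b
  -- Hessian of `w`
  set p : ι → ℝ := fun i ↦ fderiv ℝ w y (b i) with hp
  have hHw : hessianMatrix w b y = -((φ y)⁻¹ • hessianMatrix u b y) + vecMulVec p p := by
    rw [hw, hessianMatrix_negLog b hφev hφ2, hφ, hessianMatrix_add_const]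
  have hlog := neg_pair_hessian_log (a := a y) hφpos hHw hsuper
  -- Hessian of `v = η w`
  have hηw : ∀ᶠ z in 𝓝 y, DifferentiableAt ℝ (eta m) z ∧ DifferentiableAt ℝ w z := by
    filter_upwards [hφev.eventually_nhds] with z hz
    obtain ⟨hz1, hz2⟩ := hz.self_of_nhds
    exact ⟨differentiableAt_eta m z, (hasFDerivAt_negLog hz1 hz2).differentiableAt⟩
  have hw2 : DifferentiableAt ℝ (fderiv ℝ w) y := differentiableAt_fderiv_negLog hφev hφ2
  set q : ι → ℝ := fun i ↦ fderiv ℝ (eta m) y (b i) with hq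
  have hHv : hessianMatrix (barrier m u N) b y =
      eta m y • hessianMatrix w b y + vecMulVec p q + vecMulVec q p +
        w y • hessianMatrix (eta m) b y := by
    have : barrier m u N = fun z ↦ eta m z * w z := rfl
    rw [this, hessianMatrix_mul b hηw (differentiableAt_fderiv_eta m y) hw2]
  have hpsd : ∀ ξ : ι → ℝ, 0 ≤ ξ ⬝ᵥ (a y *ᵥ ξ) := fun ξ ↦
    (mul_nonneg hlam0.le (Finset.sum_nonneg fun _ _ ↦ mul_self_nonneg _)).trans (hlam ξ)
  have hprod := neg_pair_hessian_product_le ha hpsd hη hHv hlog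
  -- rewrite `η`, `q`, `H_η` in coordinates and apply the pointwise bound
  have hη_eq : eta m y = (1 - xc ⬝ᵥ xc) ^ (m + 2) := by rw [eta, hs]
  have hq_eq : q = (-(2 * ((m + 2 : ℕ) : ℝ) * (1 - xc ⬝ᵥ xc) ^ (m + 2 - 1))) • xc :=
    fderiv_eta_coord m b y
  have hHη := hessianMatrix_eta_eq m b y
  rw [hη_eq, hq_eq, hHη] at hprod
  have key := barrier_rhs_le (Hv := hessianMatrix (barrier m u N) b y) hlam0 hΛ0 hlam hΛ xc
    (β := m + 2) (by omega) hα1 hs1 hβl hwpos hprod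
  have hvw : (1 - xc ⬝ᵥ xc) ^ (m + 2) * w y = barrier m u N y := by
    rw [← hη_eq]; rfl
  rw [hvw, ← hs] at key
  exact key

end Literature.Analysis.PDE.KrylovSafonov

end
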